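import Summits.ResolutionOfSingularities.KangarooAtlas.MizutaniTowerIdeals
import Mathlib.Algebra.CharP.Reduced
import HarnessLib

/-!
# Mizutani's conjecture `m(e) = 2p^e − 1` — a tower has degree `q^s` and an infinite ground field; THEOREM F hypothesis-free

Cell topic `Summits/ResolutionOfSingularities/KangarooAtlas` (pub-rosobs); namespace
`Summit.ResolutionOfSingularities.KangarooAtlas.Mizutani`.  Part of the Lean transcription of the
in-house note MIZUTANI-PROOF-g59 (AI-written, AI-audited; *AI review is weaker than expert review*; not a
resolution theorem).  Two hypotheses of the tree's THEOREM F (`theoremF_rootTower`: `[Infinite L]`;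
`theoremF_of_mem_pow`: `[Infinite L]` and `[K : L] = q^s`) are CONSEQUENCES of the tower structure
`IsRootTower L K q x a` (`q = p^e`), and are derived here:

* `IsRootTower.finrank_eq` — `[K : L] = q^s` (MIZUTANI-PROOF-g59 §1.1: the box monomials `a^W` form an
  `L`-basis): `≤` because the box monomials span (`IsRootTower.mem_span`), `≥` because the coordinate map
  `Ω̃ : K ⊗_L K → K[u]/(u^q)` is a `K`-linear surjection (`omegaTilde_surjective`) onto a space of
  `K`-dimension `q^s` (`finrank_boxQuot`);
* `IsRootTower.not_mem_range_algebraMap` — for `e ≥ 1` no generator `a_i` lies in `L` (the Hasse–Schmidt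
  operator `D^{(e_i)}` is `L`-linear, kills `1` and sends `a_i` to `1`);
* `IsRootTower.infinite` — for `s ≥ 1`, `e ≥ 1` the ground field `L` is infinite (a finite `L` is perfect, so
  `x_i = y^q` with `y ∈ L` and `(a_i − y)^q = 0` in the field `K` would put `a_i` in `L`);
* hence `omegaTilde_bijective'`, `exists_isGenuine_of_not_mem'` and **THEOREM F with no side hypotheses**:
  `theoremF_rootTower'` (coordinate form) and `theoremF_of_mem_pow'` (intrinsic form: in every tower
  `K = L(x^{1/q})`, every `ω ∈ J^q ∖ (J^{[p]})^{p^{e−1}}` has tensor rank `≥ 2q` over `L`).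

References: [Mizutani1973HironakaGroupSchemes] (Remark 2.10; in-house proof §1.1, §2);
[Oda1983HironakaGroupSchemeII] §1 (p. 1166); [EGAIV4] Thm. 16.11.2.
-/

open MvPolynomial TensorProduct Literature.AlgebraicGeometry.Resolution

namespace Summit.ResolutionOfSingularities.KangarooAtlas.Mizutani

section Degree

variable {L K : Type*} [Field L] [Field K] [Algebra L K] {s p e : ℕ} [hp : Fact p.Prime] [CharP K p]
  {x : Fin s → L} {a : Fin s → K}

omit [CharP K p] in
/-- `[K : L] ≤ q^s`: the `q^s` box monomials `a^W` span `K` over `L`.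
[cite: Mizutani1973HironakaGroupSchemes, Remark 2.10 (in-house proof §1.1: the a^W, W in the box, form an L-basis)] -/
theorem IsRootTower.finrank_le (h : IsRootTower L K (p ^ e) x a) : Module.finrank L K ≤ (p ^ e) ^ s := by
  classical
  set bm : boxSet s (p ^ e) → K := fun W => ∏ i, a i ^ (W.1 i) with hbm
  have hrange : Set.range bm = boxMonomials a (p ^ e) := by
    ext m
    constructor
    · rintro ⟨W, rfl⟩
      exact ⟨W.1, W.2, rfl⟩
    · rintro ⟨W, hW, rfl⟩
      exact ⟨⟨W, hW⟩, rfl⟩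
  have htop : Submodule.span L (Set.range bm) = ⊤ := by
    rw [hrange]
    exact eq_top_iff.mpr fun z _ => h.mem_span z
  have hle := finrank_range_le_card (R := L) bm
  rw [Set.finrank, htop, finrank_top, card_boxSet] at hle
  exact hle

/-- `q^s ≤ [K : L]`: `Ω̃ : K ⊗_L K → K[u]/(u^q)` is a `K`-linear surjection and `dim_K K[u]/(u^q) = q^s`,
`dim_K (K ⊗_L K) = [K : L]`. [cite: Oda1983HironakaGroupSchemeII, §1 (p. 1166: k ⊗_L k ≅ k[t]/(t^q))] -/
theorem IsRootTower.le_finrank (h : IsRootTower L K (p ^ e) x a) : (p ^ e) ^ s ≤ Module.finrank L K := by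
  haveI := h.finiteDimensional
  have hsurj : Function.Surjective h.omegaLin := h.omegaTilde_surjective
  have h1 : Module.finrank K (BoxQuot (Fin s) K (p ^ e)) ≤ Module.finrank K (K ⊗[L] K) := by
    have h2 := LinearMap.finrank_range_le h.omegaLin
    rwa [LinearMap.range_eq_top.mpr hsurj, finrank_top] at h2
  rwa [finrank_boxQuot, Module.finrank_baseChange] at h1

/-- **`[K : L] = q^s`** for every tower `K = L(x^{1/q})` (`IsRootTower`): the box monomials `a^W` form an
`L`-basis of `K` (MIZUTANI-PROOF-g59 §1.1). [cite: Mizutani1973HironakaGroupSchemes, Remark 2.10 (in-house proof §1.1: [k : L] = q^s)] -/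
theorem IsRootTower.finrank_eq (h : IsRootTower L K (p ^ e) x a) : Module.finrank L K = (p ^ e) ^ s :=
  le_antisymm h.finrank_le h.le_finrank

/-- The exponent `e_i` (a single `1` in direction `i`) lies in the box when `q = p^e ≥ 2`. [folklore] -/
theorem inBox_single_one (he : 1 ≤ e) (i : Fin s) : InBox (p ^ e) (Finsupp.single i 1 : Fin s →₀ ℕ) := by
  intro j
  have hq : 1 < p ^ e := Nat.one_lt_pow (by omega) hp.out.one_lt
  rw [Finsupp.single_apply]
  split_ifs <;> omega

/-- `D^{(e_i)} a_i = 1` (`e ≥ 1`). [cite: EGAIV4, Thm. 16.11.2 (16.11.2.1: D^{(T)} a^N = C(N,T) a^{N−T})] -/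
theorem IsRootTower.hsD_single_gen (h : IsRootTower L K (p ^ e) x a) (he : 1 ≤ e) (i : Fin s) :
    h.hsD (Finsupp.single i 1) (a i) = 1 := by
  have key := h.hsD_prod_pow (inBox_single_one he i) (Finsupp.single i 1)
  have hai : (∏ j, a j ^ (Finsupp.single i 1 : Fin s →₀ ℕ) j) = a i := by
    rw [Finset.prod_eq_single i (fun j _ hj => by
      rw [Finsupp.single_apply, if_neg (Ne.symm hj), pow_zero]) (by simp)]
    rw [Finsupp.single_eq_same, pow_one]
  have hrest : (∏ j, a j ^ ((Finsupp.single i 1 : Fin s →₀ ℕ) j - (Finsupp.single i 1 : Fin s →₀ ℕ) j)) = 1 :=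
    Finset.prod_eq_one fun j _ => by rw [Nat.sub_self, pow_zero]
  rw [hai] at key
  rw [key, mchoose_self, Nat.cast_one, one_mul, hrest]

/-- `D^{(e_i)} 1 = 0` (`e ≥ 1`). [cite: EGAIV4, Thm. 16.11.2 (16.11.2.1)] -/
theorem IsRootTower.hsD_single_one (h : IsRootTower L K (p ^ e) x a) (he : 1 ≤ e) (i : Fin s) :
    h.hsD (Finsupp.single i 1) (1 : K) = 0 := by
  have key := h.hsD_prod_pow (inBox_single_one he i) 0
  have h1 : (∏ j, a j ^ (0 : Fin s →₀ ℕ) j) = 1 := by simp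
  rw [h1] at key
  rw [key, mchoose_eq_zero_of_not_le, Nat.cast_zero, zero_mul]
  intro hle
  have := hle i
  rw [Finsupp.single_eq_same, Finsupp.coe_zero, Pi.zero_apply] at this
  omega

/-- **No generator `a_i` of a tower lies in the ground field** (`e ≥ 1`): `D^{(e_i)}` is `L`-linear with
`D^{(e_i)} 1 = 0` and `D^{(e_i)} a_i = 1`. [cite: Mizutani1973HironakaGroupSchemes, Remark 2.10 (in-house proof §1.1: x p-independent, a_i ∉ L)] -/
theorem IsRootTower.not_mem_range_algebraMap (h : IsRootTower L K (p ^ e) x a) (he : 1 ≤ e) (i : Fin s) :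
    a i ∉ Set.range (algebraMap L K) := by
  rintro ⟨y, hy⟩
  have h1 := h.hsD_single_gen he i
  rw [← hy, Algebra.algebraMap_eq_smul_one, LinearMap.map_smul, h.hsD_single_one he i, smul_zero] at h1
  exact zero_ne_one h1

/-- **The ground field of a tower is infinite** (`s ≥ 1`, `e ≥ 1`): a finite `L` of characteristic `p` is
perfect, so `x_i = y^{p^e}` for some `y ∈ L`, and `(a_i − y)^{p^e} = 0` in the field `K` forces `a_i = y ∈ L`,
contradicting `not_mem_range_algebraMap`.  (Removes the hypothesis `[Infinite L]` of `theoremF_rootTower`.)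
[cite: Mizutani1973HironakaGroupSchemes, Remark 2.10 (in-house proof §1.1, §9: 𝕜 with a p-independent pair is infinite)] -/
theorem IsRootTower.infinite (h : IsRootTower L K (p ^ e) x a) (hs : 1 ≤ s) (he : 1 ≤ e) : Infinite L := by
  by_contra hfin
  rw [not_infinite_iff_finite] at hfin
  haveI : CharP L p := (Algebra.charP_iff L K p).mpr inferInstance
  set i : Fin s := ⟨0, hs⟩
  have hsurj : Function.Surjective (iterateFrobenius L p e) :=
    Finite.surjective_of_injective (iterateFrobenius_inj L p e)
  obtain ⟨y, hy⟩ := hsurj (x i)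
  rw [iterateFrobenius_def] at hy
  have hzero : (a i - algebraMap L K y) ^ p ^ e = 0 := by
    rw [sub_pow_char_pow, h.pow_eq i, ← map_pow, hy, sub_self]
  have hai : a i = algebraMap L K y :=
    sub_eq_zero.mp ((pow_eq_zero_iff (pow_ne_zero e hp.out.ne_zero)).mp hzero)
  exact h.not_mem_range_algebraMap he i ⟨y, hai.symm⟩

/-- **`Ω̃` is bijective** for every tower (the dimension hypothesis of `omegaTilde_bijective` discharged by
`finrank_eq`). [cite: Oda1983HironakaGroupSchemeII, §1 (p. 1166: R = k ⊗_L k ≅ k[t]/(t^q))] -/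
theorem IsRootTower.omegaTilde_bijective' (h : IsRootTower L K (p ^ e) x a) : Function.Bijective h.omegaTilde :=
  h.omegaTilde_bijective h.finrank_eq

/-- **`ω ∈ J^q ∖ I_S ⇒ Ω ω` has a genuine monomial**, for every tower (no dimension hypothesis).
[cite: Mizutani1973HironakaGroupSchemes, Remark 2.10 (in-house proof §1.2: genuine = J^q ∖ I_S)] -/
theorem IsRootTower.exists_isGenuine_of_not_mem' (h : IsRootTower L K (p ^ e) x a) {ω : K ⊗[L] K}
    (hJ : ω ∈ KaehlerDifferential.ideal L K ^ p ^ e) (hI : ω ∉ frobPowerIdeal L p ^ p ^ (e - 1)) :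
    ∃ M ∈ (h.Omega ω).support, IsGenuine p e M :=
  h.exists_isGenuine_of_not_mem h.finrank_eq hJ hI

/-- **THEOREM F, coordinate form, with no hypothesis on `L`** (MIZUTANI-PROOF-g59 §2 / §9): for every tower
`K = L(x^{1/q})` with `s ≥ 2`, `e ≥ 1`, every `ω ∈ K ⊗_L K` whose coordinates `Ω ω` involve only monomials of
degree `≥ q` and some genuine monomial has tensor rank `≥ 2q` over `L` (`L` is automatically infinite,
`IsRootTower.infinite`). [cite: Mizutani1973HironakaGroupSchemes, Remark 2.10 (in-house proof §2 / §9, THEOREM F)] -/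
theorem theoremF_rootTower' (h : IsRootTower L K (p ^ e) x a) (hs : 2 ≤ s) (he : 1 ≤ e)
    (ω : K ⊗[L] K) (hdeg : ∀ M ∈ (h.Omega ω).support, p ^ e ≤ M.degree)
    (hgen : ∃ M ∈ (h.Omega ω).support, IsGenuine p e M) : 2 * p ^ e ≤ tensorRank L ω := by
  haveI : Infinite L := h.infinite (by omega) he
  exact theoremF_rootTower h hs he ω hdeg hgen

/-- **THEOREM F, intrinsic form, with no side hypotheses** (MIZUTANI-PROOF-g59 §2 / §9): in every tower
`K = L(x^{1/q})` (`IsRootTower L K (p^e) x a`, any `s`, any `e`), every `ω ∈ K ⊗_L K` with `ω ∈ J^q` and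
`ω ∉ I_S = (J^{[p]})^{p^{e−1}}` has tensor rank `≥ 2q` over `L`.  (`s ≥ 2` and `e ≥ 1` follow from the existence
of a genuine monomial; `[K : L] = q^s` and `L` infinite follow from the tower structure.)
[cite: Mizutani1973HironakaGroupSchemes, Remark 2.10 (in-house proof §2, THEOREM F)] -/
theorem theoremF_of_mem_pow' (h : IsRootTower L K (p ^ e) x a) (ω : K ⊗[L] K)
    (hJ : ω ∈ KaehlerDifferential.ideal L K ^ p ^ e) (hI : ω ∉ frobPowerIdeal L p ^ p ^ (e - 1)) :
    2 * p ^ e ≤ tensorRank L ω := by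
  obtain ⟨M, hM, hgen⟩ := h.exists_isGenuine_of_not_mem' hJ hI
  obtain ⟨hs, he⟩ := two_le_of_isGenuine hgen
  exact theoremF_rootTower' h hs he ω (h.degree_le_of_mem_pow hJ) ⟨M, hM, hgen⟩

end Degree

end Summit.ResolutionOfSingularities.KangarooAtlas.Mizutani
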